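import Literature.Analysis.Calculus.FlatZeroSection   -- B7 (i)(ii): `isBigO_iteratedFDeriv_norm_fst_pow_of_zeroSection` and the frame
import Mathlib.Analysis.Calculus.MeanValue
import HarnessLib

/-!
# Functions flat along a zero section, II: VALUE-flatness forces every jet to vanish on the section (symmetry-free Landau–Kolmogorov induction)

Frame as in `FlatZeroSection.lean`: `F × P` real normed («variable» first, «parameter» last), zero section `{0} × P`, GLOBAL `iteratedFDeriv`; no
finite-dimensionality, no completeness.  THEOREMS ONLY; Mathlib + ★ `FlatZeroSection`.

* `hasFDerivAt_zero_zeroSection_of_norm_le` — a quadratic value bound `‖g q‖ ≤ C‖q.1‖^(m+2)` near a section point forces `HasFDerivAt g 0` there.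
* `exists_norm_fderiv_le_norm_fst_pow` — THE LANDAU–KOLMOGOROV STEP: `g` smooth with `‖g q‖ ≤ C‖q.1‖^(2N+2)` on a ball around `(0, z)` ⇒ `‖fderiv g q‖ ≤ K‖q.1‖^(N+1)`
  on a smaller ball.  Off the section compare `g` at `q` and at `q + t • v`, `‖v‖ = 1`, `t = ‖q.1‖^(N+1)`: the mean value inequality twice
  (`Convex.norm_image_sub_le_of_norm_fderiv_le` for `fderiv g`, whose derivative is bounded near `(0, z)` by continuity, then
  `Convex.norm_image_sub_le_of_norm_fderiv_le'`) gives `t‖Dg(q)v‖ ≤ ‖g(q + t•v)‖ + ‖g q‖ + M t²`, and `ContinuousLinearMap.opNorm_le_of_unit_norm` concludes; on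
  the section the derivative is `0` outright.
* `exists_norm_iteratedFDeriv_le_norm_fst_pow_of_isBigO` — induction on the order: value-flatness `f = O(‖q.1‖^N) ∀N` ⇒ `‖Dⁿf q‖ ≤ C‖q.1‖^N` on balls, all `n, N`
  (the order-`n` bound at exponent `2N` feeds the order-`n+1` bound at exponent `N`).
* **B7 (ii′)** `iteratedFDeriv_zeroSection_eq_zero_of_isBigO` — `f` smooth and `O(‖q.1‖^N)` near the section for every `N` ⇒ ALL iterated derivatives vanish on the
  section (the bound read at exponent `1` on the section).  NO symmetry of higher derivatives and no polarisation is used (Mathlib has Schwarz only at order 2).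
* **B7 (ii)+(ii′) packaged** `isBigO_iteratedFDeriv_norm_fst_pow_of_isBigO` — the memo's «smooth & `O(‖w‖^N) ∀N` at the section ⇒ every derivative `O(‖w‖^N) ∀N`».

Context: cell `pub/hodgecm-mathlib`, GLAESER–CHEVALLEY road G″ for `S₃` (binder LH7-p01 (g6), skeleton v2 `GlaeserSymmetricThree`, brick
`brick_iteratedFDeriv_zeroSection_eq_zero_of_isBigO` = the (ii′) head below token for token), brick **B7 «FLAT LEMMAS»**, LEAD F0P3a-plan T13-42 priority (5);
count-neutral Literature, `--kind proof --supports stmt-HodgeConjecture-24833`.  Author LH10-p02 (g8); statement read ref5 (g11) R-711 «=».  HONEST LABEL: HC_CM is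
proved only modulo the 7 printed citations (2 remaining: hLiu418 = `stmt-HodgeConjecture-24832`, h413 = `stmt-HodgeConjecture-24833`) until rung 0 closes; this file
pays no organ.

## References
* [HormanderALPDO1] L. Hörmander, *The Analysis of Linear Partial Differential Operators I*, Grundlehren 256, Springer (1983; 2nd ed. 1990), §1.1:
  (1.1.2)″ mean value inequality, Thm. 1.1.5, (1.1.7)–(1.1.8) Taylor's formula, the norm-preserving nesting of multilinear forms; §1.2 Lemma 1.2.3 (`exp(−1/t)` is `C^∞`).
* [Whitney1943] H. Whitney, *Differentiable even functions*, Duke Math. J. 10 (1943) 159–160.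
* [Glaeser1963] G. Glaeser, *Fonctions composées différentiables*, Ann. of Math. 77 (1963) 193–209.
* [Dieudonne1960] J. Dieudonné, *Foundations of Modern Analysis* (1960), (8.6.2) (mean value inequality).
-/

set_option autoImplicit false

noncomputable section

open Set Filter Topology Asymptotics
open scoped ContDiff

namespace Literature.Analysis.Calculus

variable {F P E : Type*} [NormedAddCommGroup F] [NormedSpace ℝ F] [NormedAddCommGroup P] [NormedSpace ℝ P]
  [NormedAddCommGroup E] [NormedSpace ℝ E]

/-- **Derivative `0` at a section point from a quadratic value bound.**  If `‖g q‖ ≤ C · ‖q.1‖ ^ (m + 2)` near the section point `(0, z′)`, then `g` has Fréchet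
derivative `0` there (`g (0, z′) = 0` and `g ((0, z′) + u) = O(‖u‖²) = o(‖u‖)`). [cite: HormanderALPDO1, §1.1 (1.1.2)″ and Thm. 1.1.5 (pp. 8–9)] -/
theorem hasFDerivAt_zero_zeroSection_of_norm_le {g : F × P → E} {z' : P} {C : ℝ} {m : ℕ}
    (hC : ∀ᶠ q in 𝓝 ((0, z') : F × P), ‖g q‖ ≤ C * ‖q.1‖ ^ (m + 2)) :
    HasFDerivAt g (0 : F × P →L[ℝ] E) (0, z') := by
  have hg0 : g (0, z') = 0 := by
    have h := hC.self_of_nhds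
    rw [norm_zero, zero_pow (Nat.succ_ne_zero _), mul_zero, norm_le_zero_iff] at h
    exact h
  rw [hasFDerivAt_iff_isLittleO_nhds_zero]
  simp only [hg0, sub_zero, zero_apply]
  -- transport the bound to `u ↦ (0, z′) + u` and compare with `‖u‖²`
  have ht : Tendsto (fun u : F × P => ((0, z') : F × P) + u) (𝓝 0) (𝓝 ((0, z') : F × P)) := by
    have hc : Continuous fun u : F × P => ((0, z') : F × P) + u := by fun_prop
    simpa using hc.tendsto 0
  have h1 : ∀ᶠ u in 𝓝 (0 : F × P), ‖u‖ ≤ 1 := by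
    filter_upwards [Metric.closedBall_mem_nhds (0 : F × P) one_pos] with u hu
    simpa using hu
  refine IsBigO.trans_isLittleO (g := fun u : F × P => ‖u‖ ^ 2) (IsBigO.of_bound (max C 0) ?_) (isLittleO_norm_pow_id one_lt_two)
  filter_upwards [ht.eventually hC, h1] with u hu hu1
  rw [Real.norm_of_nonneg (pow_nonneg (norm_nonneg _) _)]
  have h2 : ‖(((0, z') : F × P) + u).1‖ = ‖u.1‖ := by simp
  rw [h2] at hu
  calc ‖g ((0, z') + u)‖ ≤ C * ‖u.1‖ ^ (m + 2) := hu
    _ ≤ max C 0 * ‖u.1‖ ^ (m + 2) := by gcongr; exact le_max_left _ _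
    _ ≤ max C 0 * ‖u‖ ^ 2 := by
        refine mul_le_mul_of_nonneg_left ?_ (le_max_right _ _)
        calc ‖u.1‖ ^ (m + 2) ≤ ‖u‖ ^ (m + 2) := by gcongr; exact norm_fst_le u
          _ ≤ ‖u‖ ^ 2 := pow_le_pow_of_le_one (norm_nonneg _) hu1 (by omega)

/-- **Landau–Kolmogorov step.**  Let `g : F × P → E` be `C^∞` with `‖g q‖ ≤ C · ‖q.1‖ ^ (2N + 2)` on a ball around the section point `(0, z)`.  Then
`‖fderiv g q‖ ≤ K · ‖q.1‖ ^ (N + 1)` on a smaller ball: off the section compare `g` at `q` and at `q + t • v`, `‖v‖ = 1`, `t = ‖q.1‖ ^ (N + 1)`, by the mean value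
inequality applied twice (the second derivative is bounded near `(0, z)` by continuity), giving `t‖Dg(q)v‖ ≤ ‖g (q + t•v)‖ + ‖g q‖ + M t²`; on the section the derivative
vanishes outright (`hasFDerivAt_zero_zeroSection_of_norm_le`). [cite: HormanderALPDO1, §1.1 (1.1.2)″ (p. 9) and (1.1.8) (p. 13)] -/
theorem exists_norm_fderiv_le_norm_fst_pow {g : F × P → E} (hg : ContDiff ℝ ∞ g) (N : ℕ) {z : P} {C r : ℝ} (hr : 0 < r)
    (hC : ∀ q ∈ Metric.ball ((0, z) : F × P) r, ‖g q‖ ≤ C * ‖q.1‖ ^ (2 * N + 2)) :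
    ∃ K r' : ℝ, 0 < r' ∧ ∀ q ∈ Metric.ball ((0, z) : F × P) r', ‖fderiv ℝ g q‖ ≤ K * ‖q.1‖ ^ (N + 1) := by
  -- nonnegative constant
  set C₀ : ℝ := max C 0 with hC₀
  have hC₀0 : 0 ≤ C₀ := le_max_right _ _
  have hC' : ∀ q ∈ Metric.ball ((0, z) : F × P) r, ‖g q‖ ≤ C₀ * ‖q.1‖ ^ (2 * N + 2) := fun q hq =>
    (hC q hq).trans (mul_le_mul_of_nonneg_right (le_max_left _ _) (pow_nonneg (norm_nonneg _) _))
  -- differentiability data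
  have hg1 : Differentiable ℝ g := hg.differentiable (by simp)
  have hgf : ContDiff ℝ ∞ (fderiv ℝ g) := hg.fderiv_right (by exact_mod_cast le_top)
  have hg2 : Differentiable ℝ (fderiv ℝ g) := hgf.differentiable (by simp)
  have hA : Continuous (fderiv ℝ (fderiv ℝ g)) := hgf.continuous_fderiv (by simp)
  -- a bound `M` for the second derivative on a ball
  set M : ℝ := ‖fderiv ℝ (fderiv ℝ g) ((0, z) : F × P)‖ + 1 with hM
  have hM0 : 0 ≤ M := by positivity
  have hlt : ‖fderiv ℝ (fderiv ℝ g) ((0, z) : F × P)‖ < M := by rw [hM]; exact lt_add_one _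
  have hAn : Continuous fun x : F × P => ‖fderiv ℝ (fderiv ℝ g) x‖ := Continuous.norm (f := fderiv ℝ (fderiv ℝ g)) hA
  have hMev : ∀ᶠ x in 𝓝 ((0, z) : F × P), ‖fderiv ℝ (fderiv ℝ g) x‖ < M :=
    (hAn.continuousAt (x := ((0, z) : F × P))).eventually_lt continuousAt_const hlt
  obtain ⟨r₁, hr₁, hMball⟩ := Metric.eventually_nhds_iff_ball.1 hMev
  -- the working radius
  set ρ : ℝ := min (min r₁ r) 1 with hρ
  have hρ0 : 0 < ρ := lt_min (lt_min hr₁ hr) one_pos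
  have hρ1 : ρ ≤ r₁ := (min_le_left _ _).trans (min_le_left _ _)
  have hρr : ρ ≤ r := (min_le_left _ _).trans (min_le_right _ _)
  have hρone : ρ ≤ 1 := min_le_right _ _
  refine ⟨C₀ * 2 ^ (2 * N + 2) + C₀ + M, ρ / 4, by positivity, fun q hq => ?_⟩
  rw [Metric.mem_ball, dist_eq_norm] at hq
  have hq2 : ‖q.1‖ < ρ / 4 := by
    have h := norm_fst_le (q - ((0, z) : F × P))
    simp only [Prod.fst_sub, sub_zero] at h
    exact h.trans_lt hq
  by_cases hq0 : q.1 = 0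
  · -- on the section the derivative vanishes
    have hqeq : q = (((0 : F), q.2) : F × P) := Prod.ext hq0 rfl
    have hnhds : ∀ᶠ q' in 𝓝 (((0 : F), q.2) : F × P), ‖g q'‖ ≤ C₀ * ‖q'.1‖ ^ (2 * N + 2) := by
      have hmem : Metric.ball ((0, z) : F × P) r ∈ 𝓝 (((0 : F), q.2) : F × P) := by
        refine Metric.isOpen_ball.mem_nhds ?_
        rw [← hqeq, Metric.mem_ball, dist_eq_norm]
        linarith
      filter_upwards [hmem] with q' hq' using hC' q' hq'
    rw [hqeq, (hasFDerivAt_zero_zeroSection_of_norm_le (m := 2 * N) hnhds).fderiv, norm_zero]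
    positivity
  · -- off the section: the Landau–Kolmogorov comparison at distance `t = ‖q.1‖ ^ (N + 1)`
    have hqpos : 0 < ‖q.1‖ := norm_pos_iff.2 hq0
    set t : ℝ := ‖q.1‖ ^ (N + 1) with ht
    have ht0 : 0 < t := pow_pos hqpos _
    have htle : t ≤ ‖q.1‖ := by
      rw [ht]
      calc ‖q.1‖ ^ (N + 1) ≤ ‖q.1‖ ^ 1 := pow_le_pow_of_le_one hqpos.le (by linarith) (by omega)
        _ = ‖q.1‖ := pow_one _
    -- the big convex ball where the second derivative is bounded and the value bound holds
    have hbig : Metric.closedBall q t ⊆ Metric.ball ((0, z) : F × P) ρ := by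
      intro x hx
      rw [Metric.mem_closedBall, dist_eq_norm] at hx
      rw [Metric.mem_ball, dist_eq_norm]
      calc ‖x - (0, z)‖ = ‖(x - q) + (q - (0, z))‖ := by rw [sub_add_sub_cancel]
        _ ≤ ‖x - q‖ + ‖q - (0, z)‖ := norm_add_le _ _
        _ < t + ρ / 4 := add_lt_add_of_le_of_lt hx hq
        _ ≤ ρ / 4 + ρ / 4 := by linarith
        _ ≤ ρ := by linarith
    -- (1) the derivative is `M t`-close to `fderiv g q` on `closedBall q t`
    have hLip : ∀ x ∈ Metric.closedBall q t, ‖fderiv ℝ g x - fderiv ℝ g q‖ ≤ M * t := by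
      intro x hx
      have hmv := (convex_ball ((0, z) : F × P) ρ).norm_image_sub_le_of_norm_fderiv_le (f := fderiv ℝ g)
        (fun y _ => hg2 y) (fun y hy => (hMball y (Metric.ball_subset_ball hρ1 hy)).le)
        (hbig (Metric.mem_closedBall_self ht0.le)) (hbig hx)
      refine hmv.trans ?_
      rw [Metric.mem_closedBall, dist_eq_norm] at hx
      exact mul_le_mul_of_nonneg_left hx hM0
    -- (2) second-order comparison on the segment `[q, q + t • v]`
    refine ContinuousLinearMap.opNorm_le_of_unit_norm (by positivity) fun v hv => ?_
    set p' : F × P := q + t • v with hp'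
    have hpq : p' - q = t • v := by rw [hp', add_sub_cancel_left]
    have hp'mem : p' ∈ Metric.closedBall q t := by
      rw [Metric.mem_closedBall, dist_eq_norm, hpq, norm_smul, Real.norm_of_nonneg ht0.le, hv, mul_one]
    have hmv2 := (convex_closedBall q t).norm_image_sub_le_of_norm_fderiv_le' (f := g) (φ := fderiv ℝ g q)
      (fun y _ => hg1 y) hLip (Metric.mem_closedBall_self ht0.le) hp'mem
    rw [hpq, norm_smul, Real.norm_of_nonneg ht0.le, hv, mul_one, map_smul] at hmv2
    -- (3) the two value bounds
    have hp'r : p' ∈ Metric.ball ((0, z) : F × P) r := Metric.ball_subset_ball hρr (hbig hp'mem)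
    have hqr : q ∈ Metric.ball ((0, z) : F × P) r := Metric.ball_subset_ball hρr (hbig (Metric.mem_closedBall_self ht0.le))
    have hp1 : ‖p'.1‖ ≤ 2 * ‖q.1‖ := by
      rw [hp', Prod.fst_add, Prod.smul_fst]
      calc ‖q.1 + t • v.1‖ ≤ ‖q.1‖ + ‖t • v.1‖ := norm_add_le _ _
        _ ≤ ‖q.1‖ + t * 1 := by
            rw [norm_smul, Real.norm_of_nonneg ht0.le]
            gcongr
            exact (norm_fst_le v).trans hv.le
        _ ≤ 2 * ‖q.1‖ := by linarith
    have hgp : ‖g p'‖ ≤ C₀ * 2 ^ (2 * N + 2) * ‖q.1‖ ^ (2 * N + 2) := by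
      refine (hC' p' hp'r).trans ?_
      rw [mul_assoc, ← mul_pow]
      gcongr
    have hgq : ‖g q‖ ≤ C₀ * ‖q.1‖ ^ (2 * N + 2) := hC' q hqr
    -- (4) assemble: `t ‖Dg(q) v‖ ≤ ‖g p'‖ + ‖g q‖ + M t · t`
    have hkey : t * ‖fderiv ℝ g q v‖ ≤ (C₀ * 2 ^ (2 * N + 2) + C₀ + M) * ‖q.1‖ ^ (2 * N + 2) := by
      have htri : ‖t • fderiv ℝ g q v‖ ≤ ‖g p'‖ + ‖g q‖ + M * t * t := by
        calc ‖t • fderiv ℝ g q v‖ = ‖(g p' - g q) - (g p' - g q - t • fderiv ℝ g q v)‖ := by rw [sub_sub_cancel]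
          _ ≤ ‖g p' - g q‖ + ‖g p' - g q - t • fderiv ℝ g q v‖ := norm_sub_le _ _
          _ ≤ (‖g p'‖ + ‖g q‖) + M * t * t := add_le_add (norm_sub_le _ _) hmv2
      have htt : M * t * t = M * ‖q.1‖ ^ (2 * N + 2) := by
        rw [ht, mul_assoc, ← pow_add]
        congr 2
        omega
      rw [norm_smul, Real.norm_of_nonneg ht0.le] at htri
      calc t * ‖fderiv ℝ g q v‖ ≤ ‖g p'‖ + ‖g q‖ + M * t * t := htri
        _ ≤ C₀ * 2 ^ (2 * N + 2) * ‖q.1‖ ^ (2 * N + 2) + C₀ * ‖q.1‖ ^ (2 * N + 2) + M * ‖q.1‖ ^ (2 * N + 2) := by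
            rw [htt]; exact add_le_add (add_le_add hgp hgq) le_rfl
        _ = (C₀ * 2 ^ (2 * N + 2) + C₀ + M) * ‖q.1‖ ^ (2 * N + 2) := by ring
    -- divide by `t = ‖q.1‖ ^ (N + 1)`
    have hsplit : ‖q.1‖ ^ (2 * N + 2) = ‖q.1‖ ^ (N + 1) * t := by
      rw [ht, ← pow_add]
      congr 1
      omega
    rw [hsplit, ← mul_assoc, mul_comm t] at hkey
    exact le_of_mul_le_mul_right hkey ht0

/-- **All-orders value flatness ⇒ all-orders derivative bounds.**  If `f : F × P → E` is `C^∞` and `f = O(‖q.1‖^N)` near every section point for every `N`, then for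
every order `n` and exponent `N`, `‖Dⁿf q‖ ≤ C · ‖q.1‖ ^ N` on a ball around every section point (induction on `n` by the Landau–Kolmogorov step, feeding the order-`n`
bound with exponent `2N` into the order-`n+1` bound with exponent `N`). [cite: HormanderALPDO1, §1.1 (1.1.2)″ (p. 9) and (1.1.8) (p. 13)] -/
theorem exists_norm_iteratedFDeriv_le_norm_fst_pow_of_isBigO {f : F × P → E} (hf : ContDiff ℝ ∞ f)
    (hO : ∀ (N : ℕ) (z : P), f =O[𝓝 ((0, z) : F × P)] fun q => ‖q.1‖ ^ N) (n N : ℕ) (z : P) :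
    ∃ C r : ℝ, 0 < r ∧ ∀ q ∈ Metric.ball ((0, z) : F × P) r, ‖iteratedFDeriv ℝ n f q‖ ≤ C * ‖q.1‖ ^ N := by
  induction n generalizing N z with
  | zero =>
    obtain ⟨c, hc⟩ := (hO N z).bound
    obtain ⟨r, hr, hball⟩ := Metric.eventually_nhds_iff_ball.1 hc
    refine ⟨c, r, hr, fun q hq => ?_⟩
    rw [norm_iteratedFDeriv_zero]
    simpa [Real.norm_of_nonneg (pow_nonneg (norm_nonneg _) _)] using hball q hq
  | succ n ih =>
    rcases N with _ | N'
    · -- exponent `0`: local boundedness by continuity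
      have hcont : Continuous fun q => iteratedFDeriv ℝ (n + 1) f q := hf.continuous_iteratedFDeriv (by exact_mod_cast le_top)
      have hcn : Continuous fun q : F × P => ‖iteratedFDeriv ℝ (n + 1) f q‖ := Continuous.norm (f := fun q => iteratedFDeriv ℝ (n + 1) f q) hcont
      have hev : ∀ᶠ q in 𝓝 ((0, z) : F × P), ‖iteratedFDeriv ℝ (n + 1) f q‖ < ‖iteratedFDeriv ℝ (n + 1) f ((0, z) : F × P)‖ + 1 :=
        (hcn.continuousAt (x := ((0, z) : F × P))).eventually_lt continuousAt_const (lt_add_one _)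
      obtain ⟨r, hr, hball⟩ := Metric.eventually_nhds_iff_ball.1 hev
      exact ⟨‖iteratedFDeriv ℝ (n + 1) f ((0, z) : F × P)‖ + 1, r, hr, fun q hq => by rw [pow_zero, mul_one]; exact (hball q hq).le⟩
    · obtain ⟨C, r, hr, hC⟩ := ih (2 * N' + 2) z
      have hg : ContDiff ℝ ∞ (iteratedFDeriv ℝ n f) := hf.iteratedFDeriv_right (by exact_mod_cast le_top)
      obtain ⟨K, r', hr', hK⟩ := exists_norm_fderiv_le_norm_fst_pow hg N' hr hC
      refine ⟨K, r', hr', fun q hq => ?_⟩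
      rw [← norm_fderiv_iteratedFDeriv]
      exact hK q hq

/-- **B7 (ii′) — VALUE-FLAT ⇒ JET-FLAT ON THE SECTION.**  If `f : F × P → E` is `C^∞` and, for every `N` and every section point `(0, z)`, `f = O(‖q.1‖^N)` near
`(0, z)`, then ALL iterated derivatives of `f` vanish on the zero section.  (Symmetry of higher derivatives is NOT used: the proof is the Landau–Kolmogorov induction
`exists_norm_iteratedFDeriv_le_norm_fst_pow_of_isBigO`, read at exponent `1` on the section.)  = brick `brick_iteratedFDeriv_zeroSection_eq_zero_of_isBigO` of the
`GlaeserSymmetricThree` skeleton v2, token for token. [cite: HormanderALPDO1, §1.1 (1.1.2)″ (p. 9) and (1.1.8) (p. 13)] -/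
theorem iteratedFDeriv_zeroSection_eq_zero_of_isBigO (f : F × P → E) (hf : ContDiff ℝ ∞ f)
    (hO : ∀ (N : ℕ) (z : P), f =O[𝓝 ((0 : F), z)] fun q : F × P => ‖q.1‖ ^ N)
    (n : ℕ) (z : P) : iteratedFDeriv ℝ n f ((0 : F), z) = 0 := by
  obtain ⟨C, r, hr, hC⟩ := exists_norm_iteratedFDeriv_le_norm_fst_pow_of_isBigO hf hO n 1 z
  have h := hC (0, z) (Metric.mem_ball_self hr)
  rw [norm_zero, pow_one, mul_zero, norm_le_zero_iff] at h
  exact h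

/-- **B7 (ii)+(ii′) packaged — VALUE-FLAT ⇒ EVERY DERIVATIVE SUPER-POLYNOMIALLY SMALL.**  `f` smooth and `O(‖q.1‖^N)` near the section for every `N` ⇒ for every
order `n`, every `N` and every section point, `Dⁿf = O(‖q.1‖^N)` near it (the memo's «smooth & `O(‖w‖^N) ∀N` at `w = 0` ⇒ every derivative `O(‖w‖^N) ∀N`»). [cite: HormanderALPDO1, §1.1 Taylor's formula (1.1.7)–(1.1.8), (1.1.7)′ (pp. 12–13)] -/
theorem isBigO_iteratedFDeriv_norm_fst_pow_of_isBigO (f : F × P → E) (hf : ContDiff ℝ ∞ f)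
    (hO : ∀ (N : ℕ) (z : P), f =O[𝓝 ((0 : F), z)] fun q : F × P => ‖q.1‖ ^ N) (n N : ℕ) (z₀ : P) :
    (fun q => iteratedFDeriv ℝ n f q) =O[𝓝 ((0 : F), z₀)] fun q : F × P => ‖q.1‖ ^ N :=
  isBigO_iteratedFDeriv_norm_fst_pow_of_zeroSection hf (iteratedFDeriv_zeroSection_eq_zero_of_isBigO f hf hO) n N z₀

end Literature.Analysis.Calculus

end
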